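import Summits.QuantumFields.YangMills.Theorems.BalabanUVNodesN07Thm4RecordStructureSym152Phi
import Literature.MathematicalPhysics.QuantumFieldTheory.Balaban1983to89.Node00.TorusCoverGaugeAveragesZdPhi
import Literature.MathematicalPhysics.QuantumFieldTheory.Balaban1983to89.B8Eq131CubesRecDictionary
import HarnessLib

/-!
# N07 [B11] (= [15] = [Balaban1985Variational]) Sect. F — **ROW 9′ OF THE PREMISE OF RECORD FROM A `ℤᵈ` COVER ROW**: `NrmSymPhiOfRecord F N Mc ρ ψ … U j idx u A` (the φ-b₂
# edition of the (81)∕(1.29) normalisation in the symmetric currency, director-ym №311a∕№312a case (β)) ⟸ a residual `symCd`-axial carrier `w` on the torus (by name) + the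
# transcription's GUARDED defect row «`‖uavgZG L δ_N 1 (lift of h̄·w·u⁻¹ anchored at j) j′ w′ − 1‖ ≤ ψ`» at every `ℤᵈ` point over a cell of `D″` — pen (j-ii), torus half of the token swap

Cell `pub-ymgap`, width seat `pub-ymgap-dag-n07-w3` g13 (junction side of the K0 road; plan g93 WORD A3⁵ (3) «(j-ii) row 9′ on cells», as amended by №312a (β) and the chart reader's
row shape I.30524: ψ on the ACTUAL `u`, map `h̄·w·u⁻¹` UNCHANGED).  `--kind proof --supports stmt-QuantumFields-20541 --as helper` (K0⁷; count-neutral; THEOREMS ONLY, 0 `def`).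
[15] = [Balaban1985Variational]; [3] = [Balaban1985Averaging]; [6] = [Balaban1985RegularSpaces]; [I] = [Balaban1987RG1].

WHY.  Row 9′ of `HThm4RecSym152Phi` (dag-n07-e ✓p746119) is a statement about NODE 00's flat gauge-function averages `gaugeAvgIter (loopAvgBlockOp expMeanLogSU)` on the TORUS, at
the cell sites `Λ′_{j′}(D″)` of the meet family; the (B′) road (dag-n05-e) delivers the Landau gauge and its normalisation defect in the `ℤᵈ` transcription under the cover
(`Restr129Z`, `uavgZ`∕`uavgZG`, the cross-term tower bound).  THIS FILE is the torus half of the junction's token swap, SHAPE-AGNOSTIC in how the `ℤᵈ` side indexes its cells: the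
`ℤᵈ` row is asked at every `w′` whose anchored cover `π_{j′}(w′ + (L^{j−j′}−1)∕2·𝟙)` is a cell of `D″` (the pull-back of `LamSite` along the cover; `coverAt_surjective` makes it
exhaustive), in the GUARDED currency of FILE 40∕40c's hypothesis-free dictionary; FILE 40c `norm_coe_gaugeAvgIter_sub_one_le_of_rbar_under` converts a bound in the cross-term's
UNGUARDED currency into this one under local smallness.  The carrier `w` is supplied BY NAME (dag-n07-w6's generic `N07AxialTowerRepresentative.exists_residual_axialTower` at
`cd := symCd F N K`), so (j-i′) needs no file.
NOTE ON LEVEL `0` (for the token swap, recorded here because the pull-back makes it visible): by `Domains.Om_zero` (`Ω₀ := T`), `Λ′₀(D″) = {x : ¬ Deep 0 x}` ranges over the WHOLE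
torus outside the level-1 region, not only over print's `Λ₀ = □₀ ∖ B(□₁) ⊂ □̃` ([6] (1.29)); there `R̄⁰g = g` and the row reads `‖h̄(x)·w(x)·u(x)⁻¹ − 1‖ ≤ ψ` pointwise — the junction
must deliver `u` AGREEING with the axial tower gauge `h̄·w` off `□̃` up to `ψ` (rows 1–8 of the premise constrain `u` on the window regions only, so the swap may glue `u := h̄·w`
off `□̃`), or the def of record restricts the row to the window; either way the `ℤᵈ` supplier's cell set must be matched against this pull-back, which is why it is displayed.

WHAT IS PROVED (sorry-free; axioms standard).
* §1 `exists_anchor_of_site` (every level-`j′` site is an anchored cover `π_{j′}(w′ + c·𝟙)`).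
* §2 ★★★ `nrmSymPhiOfRecord_of_coverRow` — `NrmSymPhiOfRecord F N Mc ρ ψ ν M g K k s U j idx u A` from: a residual `w` of level `j` with `M^i(U^w)` `symCd`-axial for `i < j`, and the
  `ℤᵈ` row «`∀ hk, ∀ j′ ≤ j, ∀ w′, LamSite j′ (π_{j′}(w′ + c_{j−j′}·𝟙)) → ‖uavgZG L δ_N 1 (x ↦ ι((h̄·w·u⁻¹)(π(x + c_j·𝟙)))) j′ w′ − 1‖ ≤ ψ`», `h = axialGaugeAt (M^j(U^w)) tLo tHi ctr` the
  premise's rooted top gauge — via FILE 40c `norm_coe_gaugeAvgIter_sub_one_le_iff`.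
* §3 ★★ `nrmSymPhiOfRecord_of_coverRow_exists` (the same with the carrier produced inside from `exists_residual_axialTower`, the `ℤᵈ` row then asked for EVERY residual `symCd`-axial
  `w` — the form a supplier quantified over the carrier meets).
* §4 ★ `gaugeU_congr_of_eqOn` (rows 1–2 see `u` only on the region's sites), ★★★ `nrmSymPhiOfRecord_glued_of_coverRow` — row 9′ for a gauge `u′` GLUED from the delivered `u` (on `S`)
  and the axial tower gauge `h̄·w` (off `S`): inside-`S` towers read the `ℤᵈ` row of the delivered gauge (FILE 40c v1.1 `uavgZG_one_congr_at`), outside-`S` towers are exactly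
  normalised (`uavgZG_one_eq_one_at_of_eq_one_under`); the «no tower straddles `∂S`» dichotomy is displayed (for `S = π(□₀ᶻ)` it is the cube dictionaries' business).
* §5 (v1.1) `sitesPerDir_zero_eq_pow_mul`, ★★ `cover_tower_mem_image_cube_of_mem_cubeDomains_Om` (a positive-level cell tower lies under `π(□_{j′}) ⊆ π(□₀)`, any preimage), ★★★
  `towers_dichotomy_image_cube_zero` — §4's `hdich` DISCHARGED at `S := cover ″ cube … j 0` (= `π(□₀)`): positive levels inside, level `0` by excluded middle.
HONEST FRAMING: count-neutral; bookkeeping between two typings; the `ℤᵈ` row is a displayed HYPOTHESIS here (its supplier = (B′-4) precomposed crown + the cross-term bound + the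
junction's oscillation letters, none of which is produced by this file); `NrmSymPhiOfRecord` ∕ `HThm4RecSym152Phi` ∕ `HThm4Rec*` UNDISCHARGED; N05 ∕ N07 NOT discharged; K0⁷ ∕ K1⁹
NOT closed; counts unmoved (typed 28∕28 · discharged 8∕28); one finite 𝕋⁴ programme at fixed ε — R4 closes the conditional finite-𝕋⁴ rung `BalabanLadder.UV` only; the YM mass gap
(Clay) is NOT proved by any of this; nothing continuum ∕ ℝ⁴ ∕ OS.  No `def`, no `instance`, no `notation`, no `sorry`.

References: [3] (78)–(81) p. 30; [6] (1.29) p. 81, (1.15) p. 78; [15] (144) p. 300, (147)–(154) pp. 301–302; [I] (0.3)–(0.4) pp. 252–253, (0.11) p. 253.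
-/

set_option autoImplicit false

noncomputable section
open scoped BigOperators Matrix.Norms.L2Operator

namespace Summit.QuantumFields.YangMills.BalabanUVNodes.N07NrmSymPhiOfCoverRow

open Literature.MathematicalPhysics.QuantumFieldTheory.Balaban1983to89
open Literature.MathematicalPhysics.QuantumFieldTheory.Balaban1983to89.Node00
open Literature.MathematicalPhysics.QuantumFieldTheory.Balaban1983to89.B12RegularSpaces111 (gaugeU)
open B15Eq112TorusCover (cover)
open B14DomainGeom (Pt)
open B8Eq119TwistedAxialRec (UnderZ underZ_zero_iff)
open B8Eq131Cubes (tLo tHi ctr)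
open BlockAveragingZd (ctrShift)
open B7SectEFLinearisationRec (uavgZG)
open T4Continuum (T4Family)
open T4AxialGaugeRooted (axialGaugeAt)
open B15Eq177GaugeInvariance (blockLift)
open B12GaugeOrbits021 (IsResidual)
open GaugeField (gaugeAct)
open ExpMeanLog (expMeanLogSU deltaSU)
open Summit.QuantumFields.YangMills.BalabanUVNodes.N07NormalisationSymOfRecord (symCd)
open Summit.QuantumFields.YangMills.BalabanUVNodes.N07Thm4RecordStructureSym152Phi (NrmSymPhiOfRecord)
open Summit.QuantumFields.YangMills.BalabanUVNodes.N07AxialTowerRepresentative (exists_residual_axialTower)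

variable {F : T4Family} {N : ℕ} [NeZero N]

/-! ## §1  Every site is an anchored cover -/

/-- Every level-`j′` site of the torus is the anchored cover `π_{j′}(w′ + c·𝟙)` of some `ℤᵈ` point (the cover is onto; translate the preimage).
[cite: Balaban1987RG1, (0.1) p.251, (0.3) p.252 (bookkeeping)] -/
theorem exists_anchor_of_site {P : Params} (j' : ℕ) (c : ℤ) (y : Site P j') : ∃ w' : Pt P.d, coverAt P j' (w' + fun _ => c) = y := by
  obtain ⟨w₀, hw₀⟩ := coverAt_surjective (P := P) j' y
  exact ⟨w₀ - fun _ => c, by rwa [sub_add_cancel]⟩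

/-! ## §2  Row 9′ from the carrier and the `ℤᵈ` cover row -/

/-- ★★★ **ROW 9′ OF THE PREMISE OF RECORD FROM A `ℤᵈ` COVER ROW** ([3] (81) ∕ [6] (1.29) in the symmetric currency of [I] (0.11), φ-b₂ edition): given the datum `(j, idx)` of a separated
run, the minimiser `U`, the Landau gauge `u`, a RESIDUAL `w` of level `j` whose averages `M^i(U^w)`, `i < j`, are `symCd`-axial (the carrier), and — writing `h = axialGaugeAt (M^j(U^w)) tLo
tHi ctr` for the premise's rooted top gauge and `g = h̄·w·u⁻¹` — the transcription's GUARDED defect row «for every `j′ ≤ j` and every `ℤᵈ` point `w′` whose anchored cover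
`π_{j′}(w′ + (L^{j−j′}−1)∕2·𝟙)` is a cell site of `D″ = cubeDomains ⊓ record`, `‖uavgZG L δ_N 1 (x ↦ ι(g(π(x + (Lʲ−1)∕2·𝟙)))) j′ w′ − 1‖ ≤ ψ`», the row `NrmSymPhiOfRecord F N Mc ρ ψ …
U j idx u A` holds (FILE 40c's exact dictionary `norm_coe_gaugeAvgIter_sub_one_le_iff` at each cell, the cell pulled back along the onto cover).
[cite: Balaban1985Averaging, (78)–(81) p.30; Balaban1985RegularSpaces, (1.29) p.81; Balaban1985Variational, (150)–(154) pp.301–302; Balaban1987RG1, (0.3)–(0.4) pp.252–253, (0.11) p.253] -/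
theorem nrmSymPhiOfRecord_of_coverRow {Mc ρ : ℕ} {ψ : ℝ} {ν : Stage7Numerics} {M : ℕ} {g : ℕ → ℝ} {K k : ℕ} {s : SeqOfRecord F ν M g K k}
    {U : GaugeField (F.P K) 0 (SU N)} {j : ℕ} {idx : Pt (F.P K).d} {u : GaugeTransf (F.P K) 0 (SU N)} {A : PBond (F.P K) 0 → MatA N}
    (w : GaugeTransf (F.P K) 0 (SU N)) (hres : IsResidual j w)
    (hax : ∀ i < j, AxialGauge (symCd F N K i) (Averaging.iter (avOfRecord F N K) i (gaugeAct w U)))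
    (hrow : ∀ (hk : j ≤ (F.P K).m + (F.P K).K) (j' : ℕ), j' ≤ j → ∀ w' : Pt (F.P K).d,
      (domainsMeet (cubeDomains (F.P K) (cornerP (F.P K) Mc ρ idx) (sideP (F.P K) Mc ρ) ρ j hk) (domainsOfSeq s.Ω j hk)).LamSite j'
          (coverAt (F.P K) j' (w' + fun _ => ((ctrShift (F.P K).L (j - j') : ℕ) : ℤ))) →
        ‖((uavgZG (F.P K).L (deltaSU (Fin N)) (1 : Pt (F.P K).d → Fin (F.P K).d → (MatA N)ˣ)
            (fun x => ιSU N ((fun z => blockLift j (axialGaugeAt (Averaging.iter (avOfRecord F N K) j (gaugeAct w U))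
                (tLo (cornerP (F.P K) Mc ρ idx) ρ) (tHi (cornerP (F.P K) Mc ρ idx) (sideP (F.P K) Mc ρ) ρ) (ctr (cornerP (F.P K) Mc ρ idx) (sideP (F.P K) Mc ρ))) z *
                  w z * (u z)⁻¹) (cover (F.P K) (x + fun _ => ((ctrShift (F.P K).L j : ℕ) : ℤ))))) j' w' : (MatA N)ˣ) : MatA N) - 1‖ ≤ ψ) :
    NrmSymPhiOfRecord F N Mc ρ ψ ν M g K k s U j idx u A := by
  refine ⟨w, hres, hax, fun hk j' hj' y hy => ?_⟩
  obtain ⟨w', rfl⟩ := exists_anchor_of_site j' (((ctrShift (F.P K).L (j - j') : ℕ) : ℤ)) y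
  exact (norm_coe_gaugeAvgIter_sub_one_le_iff N hk _ hj' w' ψ).1 (hrow hk j' hj' w' hy)

/-! ## §3  The same with the carrier produced by name -/

/-- ★★ **ROW 9′ FROM A `ℤᵈ` COVER ROW QUANTIFIED OVER THE CARRIER**: if the guarded defect row of §2 holds for EVERY residual `w` of level `j` with `symCd`-axial tower (the form a
supplier that does not fix the carrier meets), then `NrmSymPhiOfRecord … U j idx u A` — the carrier exists by dag-n07-w6's `exists_residual_axialTower` at the averaged contour datum
`symCd` of [I] (0.11) (pen (j-i′) by name). [cite: Balaban1987RG1, (0.11) p.253; Balaban1985Variational, (144)–(150) pp.300–301; Balaban1985Averaging, (81) p.30] -/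
theorem nrmSymPhiOfRecord_of_coverRow_exists {Mc ρ : ℕ} {ψ : ℝ} {ν : Stage7Numerics} {M : ℕ} {g : ℕ → ℝ} {K k : ℕ} {s : SeqOfRecord F ν M g K k}
    {U : GaugeField (F.P K) 0 (SU N)} {j : ℕ} (hjK : j ≤ (F.P K).m + (F.P K).K) {idx : Pt (F.P K).d} {u : GaugeTransf (F.P K) 0 (SU N)}
    {A : PBond (F.P K) 0 → MatA N}
    (hrow : ∀ w : GaugeTransf (F.P K) 0 (SU N), IsResidual j w →
      (∀ i < j, AxialGauge (symCd F N K i) (Averaging.iter (avOfRecord F N K) i (gaugeAct w U))) →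
      ∀ (hk : j ≤ (F.P K).m + (F.P K).K) (j' : ℕ), j' ≤ j → ∀ w' : Pt (F.P K).d,
      (domainsMeet (cubeDomains (F.P K) (cornerP (F.P K) Mc ρ idx) (sideP (F.P K) Mc ρ) ρ j hk) (domainsOfSeq s.Ω j hk)).LamSite j'
          (coverAt (F.P K) j' (w' + fun _ => ((ctrShift (F.P K).L (j - j') : ℕ) : ℤ))) →
        ‖((uavgZG (F.P K).L (deltaSU (Fin N)) (1 : Pt (F.P K).d → Fin (F.P K).d → (MatA N)ˣ)
            (fun x => ιSU N ((fun z => blockLift j (axialGaugeAt (Averaging.iter (avOfRecord F N K) j (gaugeAct w U))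
                (tLo (cornerP (F.P K) Mc ρ idx) ρ) (tHi (cornerP (F.P K) Mc ρ idx) (sideP (F.P K) Mc ρ) ρ) (ctr (cornerP (F.P K) Mc ρ idx) (sideP (F.P K) Mc ρ))) z *
                  w z * (u z)⁻¹) (cover (F.P K) (x + fun _ => ((ctrShift (F.P K).L j : ℕ) : ℤ))))) j' w' : (MatA N)ˣ) : MatA N) - 1‖ ≤ ψ) :
    NrmSymPhiOfRecord F N Mc ρ ψ ν M g K k s U j idx u A := by
  obtain ⟨w, hres, hax⟩ := exists_residual_axialTower (avOfRecord F N K) (fun i => symCd F N K i) j hjK U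
  exact nrmSymPhiOfRecord_of_coverRow w hres hax (hrow w hres hax)

/-! ## §4  LEVEL-0 GLUING: the delivered gauge may be changed off print's `□₀` without touching rows 1–8; row 9′ for the glued gauge -/

omit [NeZero N] in
/-- ★ **ROWS 1–2 ARE LOCAL IN THE GAUGE**: on the bonds of `regionOfSet Y` (both ends in `Y`), the gauge-transformed field `U^{u′}` depends on `u′` only through `u′|_Y`; so a gauge
`u′` agreeing with the delivered `u` on `Y ⊇ π(□₀)` (⊇ the print box) satisfies the premise's gauge identities (rows 1–2) whenever `u` does (rows 3–8 mention `A` only).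
[cite: Balaban1985Variational, (152) p.301; Balaban1985RegularSpaces, (1.135) p.99 (bookkeeping)] -/
theorem gaugeU_congr_of_eqOn {P : Params} {Y : Set (Site P 0)} {u u' : GaugeTransf P 0 (SU N)} (hS : ∀ x ∈ Y, u' x = u x)
    (W : PBond P 0 → (MatA N)ˣ) {b : PBond P 0} (hb : b ∈ (Sect2.regionOfSet P Y).bonds) :
    gaugeU (fun x => ιSU N (u' x)) W b = gaugeU (fun x => ιSU N (u x)) W b := by
  obtain ⟨h1, h2⟩ := hb
  simp only [gaugeU, hS _ h1, hS _ h2]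

/-- ★★★ **ROW 9′ FOR THE GLUED GAUGE** ([3] (81) ∕ [6] (1.29), φ-b₂ edition; the junction's treatment of `Domains.Om_zero := T`): let `u` be the delivered Landau gauge, `w` the residual
`symCd`-axial carrier, `V := h̄·w` the axial tower gauge (`h = axialGaugeAt (M^j(U^w)) tLo tHi ctr`), and `u′` ANY gauge with `u′ = u` on a set `S` of finest sites and `u′ = V` off `S`
(`S ⊇ π(□₀)`: rows 1–8 transfer by `gaugeU_congr_of_eqOn`).  Suppose every cell of `D″` (pulled back along the anchored cover) has its block tower either INSIDE `S` — and there the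
transcription's guarded defect row for the lift of `V·u⁻¹` holds — or OUTSIDE `S` (no tower straddles `∂S`; a displayed geometric premise, for `S = π(□₀ᶻ)` the cube dictionaries).  Then
`NrmSymPhiOfRecord … U j idx u′ A` (`0 ≤ ψ`): inside, the glued and the delivered maps agree under the cell (FILE 40c `uavgZG_one_congr_at`); outside, `V·u′⁻¹ = 1` under the cell and the
guarded average is `1` (FILE 40c `uavgZG_one_eq_one_at_of_eq_one_under`). [cite: Balaban1985Averaging, (78)–(81) p.30; Balaban1985RegularSpaces, (1.29) p.81; Balaban1985Variational, (150)–(154) pp.301–302; Balaban1984PropagatorsII, (2.1) p.224 («Ω₀ := T»); Balaban1987RG1, (0.3)–(0.4) pp.252–253, (0.11) p.253] -/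
theorem nrmSymPhiOfRecord_glued_of_coverRow {Mc ρ : ℕ} {ψ : ℝ} (hψ : 0 ≤ ψ) {ν : Stage7Numerics} {M : ℕ} {g : ℕ → ℝ} {K k : ℕ} {s : SeqOfRecord F ν M g K k}
    {U : GaugeField (F.P K) 0 (SU N)} {j : ℕ} {idx : Pt (F.P K).d} {u u' : GaugeTransf (F.P K) 0 (SU N)} {A : PBond (F.P K) 0 → MatA N}
    (w : GaugeTransf (F.P K) 0 (SU N)) (hres : IsResidual j w)
    (hax : ∀ i < j, AxialGauge (symCd F N K i) (Averaging.iter (avOfRecord F N K) i (gaugeAct w U)))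
    (S : Set (Site (F.P K) 0)) (hS : ∀ x ∈ S, u' x = u x)
    (hoff : ∀ x, x ∉ S → u' x = blockLift j (axialGaugeAt (Averaging.iter (avOfRecord F N K) j (gaugeAct w U))
        (tLo (cornerP (F.P K) Mc ρ idx) ρ) (tHi (cornerP (F.P K) Mc ρ idx) (sideP (F.P K) Mc ρ) ρ) (ctr (cornerP (F.P K) Mc ρ idx) (sideP (F.P K) Mc ρ))) x * w x)
    -- no cell tower straddles `∂S` (pulled back along the anchored cover)
    (hdich : ∀ (hk : j ≤ (F.P K).m + (F.P K).K) (j' : ℕ), j' ≤ j → ∀ w' : Pt (F.P K).d,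
      (domainsMeet (cubeDomains (F.P K) (cornerP (F.P K) Mc ρ idx) (sideP (F.P K) Mc ρ) ρ j hk) (domainsOfSeq s.Ω j hk)).LamSite j'
          (coverAt (F.P K) j' (w' + fun _ => ((ctrShift (F.P K).L (j - j') : ℕ) : ℤ))) →
        (∀ x, UnderZ (F.P K).L j' w' x → cover (F.P K) (x + fun _ => ((ctrShift (F.P K).L j : ℕ) : ℤ)) ∈ S) ∨
        (∀ x, UnderZ (F.P K).L j' w' x → cover (F.P K) (x + fun _ => ((ctrShift (F.P K).L j : ℕ) : ℤ)) ∉ S))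
    -- the guarded defect row for the DELIVERED gauge, at the cells whose towers lie inside `S`
    (hrow : ∀ (hk : j ≤ (F.P K).m + (F.P K).K) (j' : ℕ), j' ≤ j → ∀ w' : Pt (F.P K).d,
      (domainsMeet (cubeDomains (F.P K) (cornerP (F.P K) Mc ρ idx) (sideP (F.P K) Mc ρ) ρ j hk) (domainsOfSeq s.Ω j hk)).LamSite j'
          (coverAt (F.P K) j' (w' + fun _ => ((ctrShift (F.P K).L (j - j') : ℕ) : ℤ))) →
        (∀ x, UnderZ (F.P K).L j' w' x → cover (F.P K) (x + fun _ => ((ctrShift (F.P K).L j : ℕ) : ℤ)) ∈ S) →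
        ‖((uavgZG (F.P K).L (deltaSU (Fin N)) (1 : Pt (F.P K).d → Fin (F.P K).d → (MatA N)ˣ)
            (fun x => ιSU N ((fun z => blockLift j (axialGaugeAt (Averaging.iter (avOfRecord F N K) j (gaugeAct w U))
                (tLo (cornerP (F.P K) Mc ρ idx) ρ) (tHi (cornerP (F.P K) Mc ρ idx) (sideP (F.P K) Mc ρ) ρ) (ctr (cornerP (F.P K) Mc ρ idx) (sideP (F.P K) Mc ρ))) z *
                  w z * (u z)⁻¹) (cover (F.P K) (x + fun _ => ((ctrShift (F.P K).L j : ℕ) : ℤ))))) j' w' : (MatA N)ˣ) : MatA N) - 1‖ ≤ ψ) :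
    NrmSymPhiOfRecord F N Mc ρ ψ ν M g K k s U j idx u' A := by
  have hodd : Odd (F.P K).L := (F.P K).hL.1
  refine nrmSymPhiOfRecord_of_coverRow w hres hax fun hk j' hj' w' hy => ?_
  rcases hdich hk j' hj' w' hy with hin | hout
  · -- tower inside `S`: the glued and the delivered maps agree under the cell
    rw [uavgZG_one_congr_at hodd (deltaSU (Fin N)) j' w'
      (g' := fun x => ιSU N ((fun z => blockLift j (axialGaugeAt (Averaging.iter (avOfRecord F N K) j (gaugeAct w U))
        (tLo (cornerP (F.P K) Mc ρ idx) ρ) (tHi (cornerP (F.P K) Mc ρ idx) (sideP (F.P K) Mc ρ) ρ) (ctr (cornerP (F.P K) Mc ρ idx) (sideP (F.P K) Mc ρ))) z *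
          w z * (u z)⁻¹) (cover (F.P K) (x + fun _ => ((ctrShift (F.P K).L j : ℕ) : ℤ)))))
      (fun x hx => by simp only [hS _ (hin x hx)])]
    exact hrow hk j' hj' w' hy hin
  · -- tower outside `S`: `V·u′⁻¹ = 1` under the cell, the guarded average is `1`
    rw [uavgZG_one_eq_one_at_of_eq_one_under hodd (deltaSU (Fin N)) j' w'
      (fun x hx => by simp only [hoff _ (hout x hx), mul_inv_cancel, map_one])]
    rw [Units.val_one, sub_self, norm_zero]
    exact hψ

/-! ## §5  (v1.1) THE NO-STRADDLE DICHOTOMY AT `S := π(□₀)`: every cell tower of `D″` lies under print's `□₀` or misses it -/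

/-- The fine period is `L^n` times the level-`n` period (`n ≤ m + K`). [cite: Balaban1987RG1, (0.1) p.251 (bookkeeping)] -/
theorem sitesPerDir_zero_eq_pow_mul {P : Params} {n : ℕ} (hn : n ≤ P.m + P.K) : P.sitesPerDir 0 = P.L ^ n * P.sitesPerDir n := by
  simp only [Params.sitesPerDir, Nat.sub_zero]
  rw [mul_left_comm, ← pow_add, Nat.add_sub_cancel' hn]

/-- ★★ **A CELL TOWER OF POSITIVE LEVEL LIES UNDER ITS CUBE**: if the anchored cover `π_{j′}(w′ + c_{j−j′}·𝟙)` of `w′` lies in `Ω′_{j′} = π_{j′}″□_{j′}^{(j′)}` (`1 ≤ j′ ≤ j ≤ m + K`) of print's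
cube family, then every fine site under `w′` at depth `j′` covers (at the anchor `c_j·𝟙`) a site of `π(□_{j′}) ⊆ π(□₀)` — whatever preimage `w′` was chosen: the corner label
`blockMap (L^{j′}) (x + c_j·𝟙) = w′ + c_{j−j′}·𝟙` (n05-e's `underZ_iff_under_add_ctrShift`) is congruent to a label of `□_{j′}^{(j′)}` modulo the level-`j′` period, and the deck translate by the
fine period lands in `□_{j′}` with the same cover. [cite: Balaban1985RegularSpaces, (1.131) p.99, (1.4) p.77, p.98; Balaban1985Variational, (144) p.300; Balaban1987RG1, (0.1) p.251, (0.3) p.252] -/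
theorem cover_tower_mem_image_cube_of_mem_cubeDomains_Om {P : Params} {a : Pt P.d} {M ρ j : ℕ} {hk : j ≤ P.m + P.K} {j' : ℕ} (hj' : 1 ≤ j') (hj'j : j' ≤ j)
    {w' : Pt P.d} (hy : coverAt P j' (w' + fun _ => ((ctrShift P.L (j - j') : ℕ) : ℤ)) ∈ (cubeDomains P a M ρ j hk).Om j')
    {x : Pt P.d} (hx : UnderZ P.L j' w' x) :
    cover P (x + fun _ => ((ctrShift P.L j : ℕ) : ℤ)) ∈ cover P '' B8Eq131Cubes.cube P.L a M ρ j 0 := by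
  obtain ⟨s, hs, hcov⟩ := (mem_cubeDomains_Om_iff hj' hj'j _).1 hy
  -- the corner label of the anchored site is `w′ + c_{j−j′}·𝟙`
  have hU : B8Ineq132.Under P.L j' (w' + fun _ => ((ctrShift P.L (j - j') : ℕ) : ℤ)) (x + fun _ => ((ctrShift P.L j : ℕ) : ℤ)) :=
    (B8Eq131CubesRecDictionary.underZ_iff_under_add_ctrShift P.hL.1 hj'j w' x).1 hx
  -- `s ≡ w′ + c` modulo the level-`j′` period
  have hdvd := (coverAt_eq_coverAt_iff j' s (w' + fun _ => ((ctrShift P.L (j - j') : ℕ) : ℤ))).1 hcov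
  choose v hv using hdvd
  -- the deck translate `Z′ := (x + c_j·𝟙) − (fine period)·v` lies under `s`, hence in `□_{j′} ⊆ □₀`, with the same cover
  have hper : ((P.sitesPerDir 0 : ℕ) : ℤ) = (P.L : ℤ) ^ j' * ((P.sitesPerDir j' : ℕ) : ℤ) := by
    rw [sitesPerDir_zero_eq_pow_mul (hj'j.trans hk)]; push_cast; ring
  refine ⟨(x + fun _ => ((ctrShift P.L j : ℕ) : ℤ)) + fun μ => ((P.sitesPerDir 0 : ℕ) : ℤ) * (-v μ), ?_, ?_⟩
  · refine B8Eq131Cubes.cube_anti (Nat.zero_le j') hj'j ((B8Eq131Cubes.mem_cube_iff P.hL.2.le).2 ⟨s, hs, fun i => ?_⟩)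
    obtain ⟨h1, h2⟩ := hU i
    have hvi := hv i
    simp only [Pi.add_apply] at h1 h2 hvi ⊢
    rw [hper]
    constructor <;> nlinarith [h1, h2, hvi]
  · rw [← coverAt_zero, coverAt_add_period]

/-- ★★★ **THE NO-STRADDLE DICHOTOMY FOR `D″ = cubeDomains ⊓ D₂` AT `S := π(□₀)`**: for every `j′ ≤ j` and every anchor `w′` of a cell of the meet, either every fine site under `w′`
covers a site of `π(□₀)` (all positive levels: `Ω′_{j′}(D″) ⊆ π_{j′}″□_{j′}^{(j′)}` and §5's tower lemma), or none does (level `0`: the tower is the single site, excluded middle) — the displayed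
premise `hdich` of `nrmSymPhiOfRecord_glued_of_coverRow` at the junction's gluing set. [cite: Balaban1985Variational, (144) p.300, (150) p.301; Balaban1985RegularSpaces, (1.131) p.99; Balaban1984PropagatorsII, (2.1)–(2.3) p.224; Balaban1987RG1, (0.1) p.251] -/
theorem towers_dichotomy_image_cube_zero {P : Params} {a : Pt P.d} {M ρ j : ℕ} {hk : j ≤ P.m + P.K} (D₂ : B6SectADomainsV1.Domains P) {j' : ℕ} (hj'j : j' ≤ j)
    (w' : Pt P.d) (hy : (domainsMeet (cubeDomains P a M ρ j hk) D₂).LamSite j' (coverAt P j' (w' + fun _ => ((ctrShift P.L (j - j') : ℕ) : ℤ)))) :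
    (∀ x, UnderZ P.L j' w' x → cover P (x + fun _ => ((ctrShift P.L j : ℕ) : ℤ)) ∈ cover P '' B8Eq131Cubes.cube P.L a M ρ j 0) ∨
    (∀ x, UnderZ P.L j' w' x → cover P (x + fun _ => ((ctrShift P.L j : ℕ) : ℤ)) ∉ cover P '' B8Eq131Cubes.cube P.L a M ρ j 0) := by
  rcases Nat.eq_zero_or_pos j' with rfl | hj'
  · -- level `0`: the tower under `w′` is `{w′}`
    by_cases h : cover P (w' + fun _ => ((ctrShift P.L j : ℕ) : ℤ)) ∈ cover P '' B8Eq131Cubes.cube P.L a M ρ j 0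
    · exact Or.inl fun x hx => by rw [(underZ_zero_iff P.L w' x).1 hx]; exact h
    · exact Or.inr fun x hx => by rw [(underZ_zero_iff P.L w' x).1 hx]; exact h
  · have hOm : coverAt P j' (w' + fun _ => ((ctrShift P.L (j - j') : ℕ) : ℤ)) ∈ (cubeDomains P a M ρ j hk).Om j' :=
      ((mem_domainsMeet_Om _ _ _ _).1 hy.1).1
    exact Or.inl fun x hx => cover_tower_mem_image_cube_of_mem_cubeDomains_Om hj' hj'j hOm hx

end Summit.QuantumFields.YangMills.BalabanUVNodes.N07NrmSymPhiOfCoverRow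

end
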